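import Literature.NumberTheory.EllipticCurves.SubgroupSelmerCocycleCriteriaProofs
import Literature.NumberTheory.EllipticCurves.PeriodIndexCorestrictionLocal
import Mathlib.Topology.Algebra.ClopenNhdofOne
import HarnessLib

/-!
# `H¹` of a closed subgroup is the union of the restrictions from the open subgroups containing it:
# the SURJECTIVITY half of `H¹(⋂ₙ Vₙ, M) = colimₙ H¹(Vₙ, M)` for continuous cochains (Serre I §2.2 Prop. 8), generic

Crux `PrintCf2.SplitBadTwoRankOneOfFacts` (stmt-BirchSwinnertonDyer-20368), S3N-FACTFREE brick R3b (the LIMIT STEP «local surjectivity at the layers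
`K*_n` ⟹ (LS↑) over `K*_∞`»), file 1: the one tool -w8 g4 reported absent from the tree (STATUS 05:24:50Z: «needs H¹(⋂ₙ Γ_n ∩ D, M) = colim
H¹(Γ_n ∩ D, M), which I do not find»). Cell `bsd-print-cf2`, EXTRA WIDTH seat `bsd-line-cf2-p1-w4` g12 (prover-bsd-line-cf2-p1-w4-g12-0);
`--supports stmt-BirchSwinnertonDyer-20368` (helper, Theses-free). HONEST FRAMING: generic profinite-group bookkeeping; closes nothing; BSD is not
proved by any of this; no summit statement is proved by this seat. No definition, no named fact, no `sorry`.

SETTING: `G` a profinite group (compact, totally disconnected topological group), `M` a discrete `G`-module whose points have open stabilisers,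
`V ≤ G` a CLOSED subgroup, `c ∈ H¹(V, M)` (continuous cochains, the tree's `subgroupH1 V M`).
* `exists_openNormalSubgroup_forall_apply_eq_zero` — the cocycle of `c` vanishes on `V ∩ N₁` for some open normal `N₁` (port of X11b's
  `Coinv.exists_openNormalSubgroup_forall_apply_eq_zero` from `Γ_K` to any profinite `G`);
* `exists_openNormalSubgroup_forall_smul_apply_eq` — some open normal `N₂` fixes every value of the cocycle;
* **`exists_resOfLe_sup_eq`** — `c` is the restriction of a class of `H¹(V ⊔ N, M)` for some open normal `N ≤ G`: with `N ≤ N₁ ⊓ N₂` the formula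
  `φ̃(v n) := φ(v)` (`v ∈ V`, `n ∈ N`) is well defined (`φ = 0` on `V ∩ N` and the cocycle identity), a continuous crossed homomorphism on the open
  subgroup `V N = V ⊔ N` (`N` fixes the values), and restricts to `φ`;
* **`exists_resOfLe_eq_of_forall_mem`** — for closed subgroups `W n ⊇ V` (any index type, directed under reverse inclusion) with `⋂ₙ W n = V`,
  every class of `H¹(V, M)` is restricted from `H¹(W n, M)` for some `n` (compactness: some `W n` lies inside the open `V ⊔ N`).
The injectivity half for the layers of a `ℤ_p`-extension is the tree's `Kato2004…exists_resLe_layerSubgroup_eq_zero`; this file is its companion.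
presearch: Serre, Galois Cohomology I §2.2 Prop. 8 («H^q(lim← G_i, lim→ A_i) = lim→ H^q(G_i, A_i)») — held [corpus: SerreGaloisCohomology1997
I §2.2]; NSW (1.5.1). No new fact. beyond-print theorem: no.

References: [SerreGaloisCohomology1997] I §2.2 Prop. 8; [NeukirchSchmidtWingberg2008] (1.5.1), I.§5.
-/

noncomputable section

open scoped Classical Pointwise

set_option linter.dupNamespace false
set_option autoImplicit false

open Literature.NumberTheory.EllipticCurves Literature.NumberTheory.GaloisRepresentations

namespace Summit.BirchSwinnertonDyer.BirchSwinnertonDyer.Theorems.PrintCf2.H1Colim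

universe u

variable {G : Type u} [Group G] [TopologicalSpace G] [IsTopologicalGroup G] [CompactSpace G] [TotallyDisconnectedSpace G]
  {M : Type u} [AddCommGroup M] [DistribMulAction G M] [TopologicalSpace M] [DiscreteTopology M]

/-- **The zero set of a continuous cocycle of `V ≤ G` contains `V ∩ N₁` for an open normal `N₁ ≤ G`** (continuity of the cocycle, discreteness of
`M`, profiniteness of `G`: `ProfiniteGrp.exist_openNormalSubgroup_sub_open_nhds_of_one`). X11b's `Coinv.exists_openNormalSubgroup_forall_apply_eq_zero`
for an arbitrary profinite ambient group. [cite: SerreGaloisCohomology1997, I §2.2] -/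
theorem exists_openNormalSubgroup_forall_apply_eq_zero (V : Subgroup G) (φ : contOneCocycles (discreteTopRep V M)) :
    ∃ N₁ : OpenNormalSubgroup G, ∀ (v : G) (hv : v ∈ V), v ∈ N₁ → φ.1 ⟨v, hv⟩ = 0 := by
  have hz : IsOpen {h : V | φ.1 h = 0} := (isOpen_discrete ({0} : Set M)).preimage φ.1.continuous
  obtain ⟨U0, hU0, hU0eq⟩ := isOpen_induced_iff.mp hz
  have h1U0 : (1 : G) ∈ U0 := by
    have h1 : (1 : V) ∈ Subtype.val ⁻¹' U0 := by
      rw [hU0eq]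
      exact contOneCocycles.apply_one φ
    exact h1
  obtain ⟨N₁, hN₁⟩ := ProfiniteGrp.exist_openNormalSubgroup_sub_open_nhds_of_one hU0 h1U0
  refine ⟨N₁, fun v hv hvN ↦ ?_⟩
  have hmem : (⟨v, hv⟩ : V) ∈ Subtype.val ⁻¹' U0 := hN₁ hvN
  rw [hU0eq] at hmem
  exact hmem

/-- **An open normal subgroup `N₂ ≤ G` fixes every value of a continuous cocycle of a closed `V ≤ G`** (the cocycle has finitely many values,
each with an open stabiliser). [cite: SerreGaloisCohomology1997, I §2.2] [cite: NeukirchSchmidtWingberg2008, I.§5] -/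
theorem exists_openNormalSubgroup_forall_smul_apply_eq (hstab : ∀ m : M, IsOpen {g : G | g • m = m}) (V : Subgroup G)
    (hV : IsClosed (V : Set G)) (φ : contOneCocycles (discreteTopRep V M)) :
    ∃ N₂ : OpenNormalSubgroup G, ∀ n ∈ N₂, ∀ v : V, n • φ.1 v = φ.1 v := by
  haveI : CompactSpace V := isCompact_iff_compactSpace.mp hV.isCompact
  have hfin : (Set.range φ.1).Finite := (isCompact_range φ.1.continuous).finite_of_discrete
  set Ufix : Set G := {τ | ∀ m ∈ Set.range φ.1, τ • m = m} with hUfix_def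
  have hUfix : IsOpen Ufix := by
    have e : Ufix = ⋂ m ∈ Set.range φ.1, {g : G | g • m = m} := by
      ext τ
      simp only [hUfix_def, Set.mem_setOf_eq, Set.mem_iInter]
    rw [e]
    exact hfin.isOpen_biInter fun m _ ↦ hstab m
  have h1 : (1 : G) ∈ Ufix := fun m _ ↦ one_smul _ m
  obtain ⟨N₂, hN₂⟩ := ProfiniteGrp.exist_openNormalSubgroup_sub_open_nhds_of_one hUfix h1
  exact ⟨N₂, fun n hn v ↦ hN₂ hn _ ⟨v, rfl⟩⟩

/-- **Every class of `H¹(V, M)`, `V ≤ G` closed, is restricted from `H¹(V ⊔ N, M)` for some open normal subgroup `N ≤ G`.** With `N ≤ N₁ ⊓ N₂`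
(zero set, stabiliser of the values) the crossed homomorphism `φ` of the class extends to the open subgroup `V N = V ⊔ N` by `φ̃(v n) := φ(v)`:
well defined since `v n = v' n'` forces `v'⁻¹ v ∈ V ∩ N`, where `φ` vanishes, so `φ(v) = φ(v') + v' • φ(v'⁻¹ v) = φ(v')`; a crossed homomorphism
since `(v n)(v' n') = (v v')(v'⁻¹ n v' · n')` and `n` fixes `φ(v')`; continuous since constant on the cosets `x N`. This is the surjectivity half
of Serre's `H¹(lim← G/U, M^U) = H¹(G, M)`-type continuity statement, for the pair `V ≤ V N`. [cite: SerreGaloisCohomology1997, I §2.2 Prop. 8]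
[cite: NeukirchSchmidtWingberg2008, (1.5.1)] -/
theorem exists_resOfLe_sup_eq (hstab : ∀ m : M, IsOpen {g : G | g • m = m}) (V : Subgroup G) (hV : IsClosed (V : Set G))
    (c : subgroupH1 V M) :
    ∃ (N : OpenNormalSubgroup G) (c' : subgroupH1 (V ⊔ (N : Subgroup G)) M), resOfLe M (le_sup_left : V ≤ V ⊔ (N : Subgroup G)) c' = c := by
  obtain ⟨φ, rfl⟩ := oneCocycleClass_surjective _ c
  obtain ⟨N₁, hN₁⟩ := exists_openNormalSubgroup_forall_apply_eq_zero V φ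
  obtain ⟨N₂, hN₂⟩ := exists_openNormalSubgroup_forall_smul_apply_eq hstab V hV φ
  set N : OpenNormalSubgroup G := N₁ ⊓ N₂ with hNdef
  have hNN₁ : ∀ g : G, g ∈ N → g ∈ N₁ := fun g hg ↦ (inf_le_left : N₁ ⊓ N₂ ≤ N₁) hg
  have hNN₂ : ∀ g : G, g ∈ N → g ∈ N₂ := fun g hg ↦ (inf_le_right : N₁ ⊓ N₂ ≤ N₂) hg
  have hmemN : ∀ g : G, g ∈ (N : Subgroup G) ↔ g ∈ N := fun _ ↦ Iff.rfl
  -- every element of `V ⊔ N` is `v * n`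
  have hdec : ∀ x : ↥(V ⊔ (N : Subgroup G)), ∃ v : V, ∃ n : G, n ∈ N ∧ (x : G) = v * n := by
    intro x
    have hx : (x : G) ∈ ((V ⊔ (N : Subgroup G) : Subgroup G) : Set G) := x.2
    rw [Subgroup.mul_normal] at hx
    obtain ⟨v, hv, n, hn, hvn⟩ := Set.mem_mul.1 hx
    exact ⟨⟨v, hv⟩, n, hn, hvn.symm⟩
  choose vOf nOf hnOf hdecOf using hdec
  -- the cocycle identity lets us compare two decompositions
  have hφmul : ∀ v w : V, φ.1 (v * w) = φ.1 v + (v : G) • φ.1 w := fun v w ↦ φ.2 v w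
  have hφV : ∀ (v v' : V) (n n' : G), n ∈ N → n' ∈ N → (v : G) * n = v' * n' → φ.1 v = φ.1 v' := by
    intro v v' n n' hn hn' he
    have hq : ((v'⁻¹ * v : V) : G) = n' * n⁻¹ := by
      rw [Subgroup.coe_mul, Subgroup.coe_inv, inv_mul_eq_iff_eq_mul, ← mul_assoc, ← he, mul_inv_cancel_right]
    have hmem : ((v'⁻¹ * v : V) : G) ∈ N := by
      rw [hq]
      exact (N : Subgroup G).mul_mem hn' ((N : Subgroup G).inv_mem hn)
    have h0 : φ.1 (v'⁻¹ * v) = 0 := hN₁ _ (v'⁻¹ * v).2 (hNN₁ _ hmem)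
    have e : v = v' * (v'⁻¹ * v) := by rw [mul_inv_cancel_left]
    rw [e, hφmul, h0, smul_zero, add_zero]
  -- the extension and its defining property
  set f : ↥(V ⊔ (N : Subgroup G)) → M := fun x ↦ φ.1 (vOf x) with hfdef
  have hf : ∀ (v : V) (n : G) (hn : n ∈ N) (hx : (v : G) * n ∈ V ⊔ (N : Subgroup G)), f ⟨(v : G) * n, hx⟩ = φ.1 v := by
    intro v n hn hx
    exact hφV _ _ _ _ (hnOf _) hn (hdecOf ⟨(v : G) * n, hx⟩).symm
  have hfx : ∀ x : ↥(V ⊔ (N : Subgroup G)), f x = φ.1 (vOf x) := fun _ ↦ rfl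
  -- membership helper: `v * n ∈ V ⊔ N`
  have hmemVN : ∀ (v : G) (n : G), v ∈ V → n ∈ N → v * n ∈ V ⊔ (N : Subgroup G) := fun v n hv hn ↦
    (V ⊔ (N : Subgroup G)).mul_mem (Subgroup.mem_sup_left hv) (Subgroup.mem_sup_right hn)
  -- continuity: `f` is constant on the cosets `x N`
  have hcont : Continuous f := by
    refine continuous_discrete_rng.2 fun b ↦ isOpen_iff_forall_mem_open.2 fun x hx ↦ ?_
    refine ⟨{y | (x : G)⁻¹ * y ∈ (N : Subgroup G)}, fun y hy ↦ ?_, ?_, ?_⟩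
    · -- `y = x * n₀ = vOf x * (nOf x * n₀)`
      have hy' : (x : G)⁻¹ * y ∈ N := hy
      have e : (y : G) = (vOf x : G) * (nOf x * ((x : G)⁻¹ * y)) := by
        rw [← mul_assoc, ← hdecOf x, mul_inv_cancel_left]
      have hyx : f y = f x := by
        have h1 : f ⟨(vOf x : G) * (nOf x * ((x : G)⁻¹ * y)), e ▸ y.2⟩ = φ.1 (vOf x) :=
          hf _ _ ((N : Subgroup G).mul_mem (hnOf x) hy') _
        have h2 : (⟨(vOf x : G) * (nOf x * ((x : G)⁻¹ * y)), e ▸ y.2⟩ : ↥(V ⊔ (N : Subgroup G))) = y := Subtype.ext e.symm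
        rw [h2] at h1
        rw [h1, hfx]
      change f y ∈ ({b} : Set M)
      rw [hyx]
      exact hx
    · exact N.isOpen'.preimage ((continuous_const.mul continuous_subtype_val))
    · change (x : G)⁻¹ * x ∈ (N : Subgroup G)
      rw [inv_mul_cancel]
      exact one_mem _
  -- the crossed-homomorphism identity on `V N`
  let F : C(↥(V ⊔ (N : Subgroup G)), M) := ⟨f, hcont⟩
  have hF : F ∈ contOneCocycles (discreteTopRep (↥(V ⊔ (N : Subgroup G))) M) := by
    rw [mem_contOneCocycles_iff]
    intro x y
    change f (x * y) = f x + (x : G) • f y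
    -- `x = v n`, `y = v' n'`, `x y = (v v') (v'⁻¹ n v' n')`
    have hn'' : ((vOf y : V) : G)⁻¹ * nOf x * (vOf y : G) * nOf y ∈ N := by
      refine (N : Subgroup G).mul_mem ?_ (hnOf y)
      have h1 := (inferInstance : (N : Subgroup G).Normal).conj_mem _ (hnOf x) ((vOf y : V) : G)⁻¹
      rwa [inv_inv] at h1
    have e : ((x * y : ↥(V ⊔ (N : Subgroup G))) : G) = ((vOf x * vOf y : V) : G) * (((vOf y : V) : G)⁻¹ * nOf x * (vOf y : G) * nOf y) := by
      rw [Subgroup.coe_mul, hdecOf x, hdecOf y, Subgroup.coe_mul]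
      group
    have h1 : f (x * y) = φ.1 (vOf x * vOf y) := by
      have h2 : (x * y : ↥(V ⊔ (N : Subgroup G))) = ⟨((vOf x * vOf y : V) : G) * (((vOf y : V) : G)⁻¹ * nOf x * (vOf y : G) * nOf y),
          e ▸ (x * y).2⟩ := Subtype.ext e
      rw [h2]
      exact hf _ _ hn'' _
    rw [h1, hφmul, hfx, hfx, hdecOf x, mul_smul, hN₂ _ (hNN₂ _ (hnOf x))]
  refine ⟨N, oneCocycleClass _ ⟨F, hF⟩, ?_⟩
  -- the restriction of `[F]` to `V` is `[φ]`
  rw [Literature.NumberTheory.EllipticCurves.resOfLe, resH1Hom_oneCocycleClass]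
  congr 1
  apply Subtype.ext
  ext v
  rw [contOneCocycles.pullback_apply]
  change f ⟨(v : G), _⟩ = φ.1 v
  have h1 : f ⟨(v : G) * 1, hmemVN _ _ v.2 (one_mem _)⟩ = φ.1 v := hf v 1 (one_mem _) _
  have h2 : (⟨(v : G) * 1, hmemVN _ _ v.2 (one_mem _)⟩ : ↥(V ⊔ (N : Subgroup G))) = ⟨(v : G), Subgroup.mem_sup_left v.2⟩ :=
    Subtype.ext (mul_one _)
  rw [h2] at h1
  exact h1

/-- **`H¹(⋂ₙ Wₙ, M) = ⋃ₙ res H¹(Wₙ, M)` (surjectivity half of Serre I §2.2 Prop. 8 for a directed family of closed subgroups).** If the closed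
subgroups `W n ⊇ V` are directed under reverse inclusion and `⋂ₙ W n ≤ V` (so `= V`), then every class of `H¹(V, M)` is the restriction of a class
of `H¹(W n, M)` for some `n`: by `exists_resOfLe_sup_eq` it comes from the OPEN subgroup `V ⊔ N`, and by compactness some `W n` lies inside
`V ⊔ N` (`IsCompact.elim_directed_family_closed` on the closed sets `W n ∖ (V ⊔ N)`). Companion of the injectivity half
`Kato2004…exists_resLe_layerSubgroup_eq_zero`. [cite: SerreGaloisCohomology1997, I §2.2 Prop. 8] [cite: NeukirchSchmidtWingberg2008, (1.5.1)] -/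
theorem exists_resOfLe_eq_of_forall_mem {ι : Type*} [Nonempty ι] (hstab : ∀ m : M, IsOpen {g : G | g • m = m}) (V : Subgroup G)
    (hV : IsClosed (V : Set G)) (W : ι → Subgroup G) (hWc : ∀ i, IsClosed (W i : Set G)) (hVW : ∀ i, V ≤ W i)
    (hdir : Directed (fun i j ↦ W j ≤ W i) id) (hinf : ∀ g : G, (∀ i, g ∈ W i) → g ∈ V) (c : subgroupH1 V M) :
    ∃ (i : ι) (c' : subgroupH1 (W i) M), resOfLe M (hVW i) c' = c := by
  obtain ⟨N, c₀, hc₀⟩ := exists_resOfLe_sup_eq hstab V hV c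
  -- some `W i` lies inside the open subgroup `V ⊔ N`
  have hopen : IsOpen ((V ⊔ (N : Subgroup G) : Subgroup G) : Set G) :=
    Subgroup.isOpen_mono (le_sup_right : (N : Subgroup G) ≤ V ⊔ (N : Subgroup G)) N.isOpen'
  obtain ⟨i, hi⟩ : ∃ i, (Set.univ : Set G) ∩ ((W i : Set G) ∩ ((V ⊔ (N : Subgroup G) : Subgroup G) : Set G)ᶜ) = ∅ := by
    refine isCompact_univ.elim_directed_family_closed (fun i ↦ (W i : Set G) ∩ ((V ⊔ (N : Subgroup G) : Subgroup G) : Set G)ᶜ)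
      (fun i ↦ (hWc i).inter hopen.isClosed_compl) ?_ ?_
    · refine Set.eq_empty_iff_forall_notMem.2 fun g hg ↦ ?_
      have hg' := (Set.mem_iInter.1 hg.2)
      have hgV : g ∈ V := hinf g fun i ↦ (hg' i).1
      exact (hg' (Classical.arbitrary ι)).2 (Subgroup.mem_sup_left hgV)
    · intro i j
      obtain ⟨k, hk₁, hk₂⟩ := hdir i j
      exact ⟨k, fun g hg ↦ ⟨hk₁ hg.1, hg.2⟩, fun g hg ↦ ⟨hk₂ hg.1, hg.2⟩⟩
  have hWi : W i ≤ V ⊔ (N : Subgroup G) := by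
    intro g hg
    by_contra h
    have : g ∈ (Set.univ : Set G) ∩ ((W i : Set G) ∩ ((V ⊔ (N : Subgroup G) : Subgroup G) : Set G)ᶜ) := ⟨Set.mem_univ _, hg, h⟩
    rw [hi] at this
    exact this
  refine ⟨i, resOfLe M hWi c₀, ?_⟩
  rw [← AddMonoidHom.comp_apply, resOfLe_comp_holds]
  exact hc₀

end Summit.BirchSwinnertonDyer.BirchSwinnertonDyer.Theorems.PrintCf2.H1Colim

end
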